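import Summits.Ventures.PackingBounds.Energy.GramDataCheck
import HarnessLib

/-!
# Kernel-checkable Gram identity `S·Y = L Lᵀ + E`, fast variant (structural dot products)

Framing: lottery ticket; floor = certified bounds/negative ranges. Venture `PackingBounds`, cell
`pub-packcert`, energy family E3PT (pub-packcert-energy gen 15; KERNEL-D6 route at SDP degree 8).

`GramData.checkRows` (module `GramDataCheck`) evaluates every dot product `Σ_c L_ic L_jc` through indexed
access `ent L i c` (a list walk per entry), i.e. `O(r²)` kernel steps per matrix entry — fine at `r ≈ 75`
(d = 6) but ≈ 1 min per ROW at `r = 158` (d = 8). `checkRowsF` computes the same dot products structurally on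
the two row lists (`dotL`, `O(r)` per entry); `of_checkRowsF` returns exactly the conclusion of
`GramData.of_checkRows` (so `GramData.psd_of_checks` applies unchanged), given that every row of `L` has
length `r` (`decide`).
-/

namespace Summit.Ventures.PackingBounds.Energy.GramData

open Finset

/-- Structural dot product of two integer lists (entries beyond the shorter list are ignored). -/
def dotL : List ℤ → List ℤ → ℤ
  | [], _ => 0
  | _ :: _, [] => 0
  | x :: xs, y :: ys => x * y + dotL xs ys

/-- `Σ_{c<n} a[c]·b[c]` by recursion on `n` (indexed access; the list analogue of `dotRows`). -/
def pdot (a b : List ℤ) : ℕ → ℤ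
  | 0 => 0
  | n + 1 => pdot a b n + a.getD n 0 * b.getD n 0

/-- `dotRows` is `pdot` of the two rows. -/
theorem dotRows_eq_pdot (L : List (List ℤ)) (i j : ℕ) : ∀ n, dotRows L i j n = pdot (L.getD i []) (L.getD j []) n
  | 0 => rfl
  | n + 1 => by rw [dotRows, pdot, dotRows_eq_pdot L i j n]; rfl

/-- Shifting `pdot` past the heads. -/
theorem pdot_cons (x y : ℤ) (xs ys : List ℤ) : ∀ n, pdot (x :: xs) (y :: ys) (n + 1) = x * y + pdot xs ys n
  | 0 => by simp [pdot]
  | n + 1 => by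
    rw [pdot, pdot_cons x y xs ys n, pdot]
    simp only [List.getD_cons_succ]
    ring

/-- `dotL a b = pdot a b n` for lists of common length `n`. -/
theorem dotL_eq_pdot : ∀ (a b : List ℤ) (n : ℕ), a.length = n → b.length = n → dotL a b = pdot a b n
  | [], b, n, ha, _ => by
    subst ha; simp [dotL, pdot]
  | x :: xs, [], n, ha, hb => by
    simp at ha hb; omega
  | x :: xs, y :: ys, n, ha, hb => by
    obtain ⟨m, rfl⟩ : ∃ m, n = m + 1 := ⟨xs.length, by simpa using ha.symm⟩
    rw [dotL, pdot_cons, dotL_eq_pdot xs ys m (by simpa using ha) (by simpa using hb)]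

/-- Rows `i0 ≤ i < i1`, columns `j < r`: `Y_{ij} = dotL L_i L_j + E_{ij}` and `E_{ij} = E_{ji}` (structural dot products). -/
def checkRowsF (r i0 i1 : ℕ) (Y L E : List (List ℤ)) : Bool :=
  ((List.range i1).filter (fun i => i0 ≤ i)).all fun i => (List.range r).all fun j =>
    (ent Y i j == dotL (L.getD i []) (L.getD j []) + ent E i j) && (ent E i j == ent E j i)

/-- Every row `i < r` of `L` has length `r`. -/
def checkLen (r : ℕ) (L : List (List ℤ)) : Bool :=
  (List.range r).all fun i => (L.getD i []).length == r

/-- Unpack a checked row chunk (fast variant): the conclusion of `GramData.of_checkRows` with `s = r`. -/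
theorem of_checkRowsF {r i0 i1 : ℕ} {Y L E : List (List ℤ)} (h : checkRowsF r i0 i1 Y L E = true)
    (hL : checkLen r L = true) :
    ∀ i j, i0 ≤ i → i < i1 → i < r → j < r →
      ent Y i j = dotRows L i j r + ent E i j ∧ ent E i j = ent E j i := by
  intro i j h0 h1 hir hjr
  unfold checkRowsF at h
  rw [List.all_eq_true] at h
  have hi := h i (by simp [List.mem_filter, h1, h0])
  rw [List.all_eq_true] at hi
  have hj := hi j (by simpa using hjr)
  simp only [Bool.and_eq_true, beq_iff_eq] at hj
  unfold checkLen at hL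
  rw [List.all_eq_true] at hL
  have hli : (L.getD i []).length = r := by simpa using hL i (by simpa using hir)
  have hlj : (L.getD j []).length = r := by simpa using hL j (by simpa using hjr)
  refine ⟨?_, hj.2⟩
  rw [hj.1, dotL_eq_pdot _ _ r hli hlj, dotRows_eq_pdot]

end Summit.Ventures.PackingBounds.Energy.GramData
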